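import Mathlib
import Literature.Computability.AlgebraicComplexity.GroupTheoreticMatMul

/-!
# Packing with the full sumset `(A_l − B_l) + (C_l − C_l)` (the planner's U14 read literally: "U14⁺")

Support file for route `MatrixMultiplication/GroupTheoreticSTPP`, crux `stmt-MatrixMultiplication-0597`,
cell `mm-stpp` (D-0046), CENSUS-PLAN §3 U14 / STATUS note «U14⁺» (mm-stpp-eng-1).

For a census-STPP family (`IsSTPP`) in a finite abelian group `H` with all `C t` non-empty, the difference
sets `D_t = A_t − B_t` are pairwise disjoint, `|D_t| = |A_t||B_t|`, and for `t ≠ l` the set `D_t` avoids the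
whole sumset `X_l = (A_l − B_l) + (C_l − C_l)` (pattern `(t, l, l)` of CKSU Def. 5.1).  Hence

* `sum_card_mul_add_card_sumset_le` — `∑_{t ≠ l} |A_t||B_t| + |(A_l − B_l) + (C_l − C_l)| ≤ |H|`.

The planner's U14 (`volume_add_sum_card_mul_le` in `HOME/mm-stpp-plan/PackingSketch.lean`) is the same
statement with `X_l` replaced by one of its translates `(A_l − B_l + C_l) − u₀` (`V_l` elements); U14⁺ is
stronger on structured members, e.g. for a punctured-axes triple of `Cyc_n³` one has `|X_l| = n(n−1)²`, so an
STPP family of `(n−1)³`-shaped triples containing a frame triple has `k ≤ 3` for every `n ≥ 6`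
(`(k−1)(n−1)² + n(n−1)² ≤ n³`; arithmetic, not formalized here).

WHAT THIS IS NOT: no `ω` statement; a packing inequality only.
-/

-- single-conjunct summit: the mandated namespace repeats `MatrixMultiplication`.
set_option linter.dupNamespace false

namespace Summit.MatrixMultiplication.MatrixMultiplication.Theorems

namespace STPPPackingSumset

open Finset Literature.Computability.AlgebraicComplexity
open scoped Pointwise

variable {H : Type*} [AddCommGroup H] [Fintype H] [DecidableEq H] {N : ℕ} {A B C : Fin N → Finset H}

omit [Fintype H] in
/-- `|A_t − B_t| = |A_t| |B_t|` for a member of an `IsSTPP` family with `C_t ≠ ∅` (the TPP of triple `t`).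
[cite: CohnKleinbergSzegedyUmans2005, Def. 5.1] -/
theorem card_sub_eq (h : IsSTPP A B C) (t : Fin N) (hC : (C t).Nonempty) :
    (A t - B t).card = (A t).card * (B t).card := by
  obtain ⟨c, hc⟩ := hC
  rw [← image_sub_product, card_image_of_injOn, card_product]
  rintro ⟨a, b⟩ hx ⟨a', b'⟩ hy (hxy : a - b = a' - b')
  simp only [coe_product, Set.mem_prod, mem_coe] at hx hy
  have key : (a - a') + (b' - b) + (c - c) = 0 := by
    have : a = a' - b' + b := by rw [← hxy]; abel
    rw [this]; abel
  obtain ⟨-, -, hs, ht, -⟩ := h t t t a' hy.1 a hx.1 b hx.2 b' hy.2 c hc c hc key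
  rw [hs, ht]

omit [Fintype H] in
/-- Difference sets of two different members are disjoint (pattern `(t, t', t')`).
[cite: CohnKleinbergSzegedyUmans2005, Def. 5.1] -/
theorem disjoint_sub_sub (h : IsSTPP A B C) {t t' : Fin N} (htt' : t ≠ t') (hC : (C t').Nonempty) :
    Disjoint (A t - B t) (A t' - B t') := by
  obtain ⟨c, hc⟩ := hC
  rw [disjoint_left]
  intro x hx hx'
  rw [mem_sub] at hx hx'
  obtain ⟨a, ha, b, hb, rfl⟩ := hx
  obtain ⟨a', ha', b', hb', he⟩ := hx'
  have key : (a - a') + (b' - b) + (c - c) = 0 := by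
    have : a = a' - b' + b := by rw [he]; abel
    rw [this]; abel
  obtain ⟨hij, -, -, -, -⟩ := h t t' t' a' ha' a ha b hb b' hb' c hc c hc key
  exact htt' hij

omit [Fintype H] in
/-- For `t ≠ l`, the difference set `A_t − B_t` avoids the full sumset `(A_l − B_l) + (C_l − C_l)`
(pattern `(t, l, l)` of CKSU Def. 5.1). [cite: CohnKleinbergSzegedyUmans2005, Def. 5.1] -/
theorem disjoint_sub_sumset (h : IsSTPP A B C) {t l : Fin N} (htl : t ≠ l) :
    Disjoint (A t - B t) ((A l - B l) + (C l - C l)) := by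
  rw [disjoint_left]
  intro x hx hx'
  rw [mem_sub] at hx
  obtain ⟨a, ha, b, hb, rfl⟩ := hx
  rw [mem_add] at hx'
  obtain ⟨d, hd, e, he, hde⟩ := hx'
  rw [mem_sub] at hd he
  obtain ⟨a', ha', b', hb', rfl⟩ := hd
  obtain ⟨c, hc, c', hc', rfl⟩ := he
  have key : (a - a') + (b' - b) + (c' - c) = 0 := by
    have : a = a' - b' + (c - c') + b := by rw [hde]; abel
    rw [this]; abel
  obtain ⟨hij, -, -, -, -⟩ := h t l l a' ha' a ha b hb b' hb' c hc c' hc' key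
  exact htl hij

/-- **U14⁺.** For an `IsSTPP` family with all `C t` non-empty, in a finite abelian group `H`, and any
index `l`: `∑_{t ≠ l} |A_t||B_t| + |(A_l − B_l) + (C_l − C_l)| ≤ |H|`. [original] -/
theorem sum_card_mul_add_card_sumset_le (h : IsSTPP A B C) (hC : ∀ t, (C t).Nonempty) (l : Fin N) :
    (∑ t ∈ univ.erase l, (A t).card * (B t).card) + ((A l - B l) + (C l - C l)).card
      ≤ Fintype.card H := by
  classical
  -- the disjoint union of the `D_t`, `t ≠ l`
  set U : Finset H := (univ.erase l).biUnion fun t => A t - B t with hU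
  have hUcard : U.card = ∑ t ∈ univ.erase l, (A t).card * (B t).card := by
    rw [hU, card_biUnion]
    · exact sum_congr rfl fun t _ => card_sub_eq h t (hC t)
    · intro t _ t' _ htt'
      exact disjoint_sub_sub h htt' (hC t')
  have hdisj : Disjoint U ((A l - B l) + (C l - C l)) := by
    rw [hU, disjoint_biUnion_left]
    intro t ht
    exact disjoint_sub_sumset h (ne_of_mem_erase ht)
  calc (∑ t ∈ univ.erase l, (A t).card * (B t).card) + ((A l - B l) + (C l - C l)).card
      = (U ∪ ((A l - B l) + (C l - C l))).card := by rw [card_union_of_disjoint hdisj, hUcard]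
    _ ≤ Fintype.card H := card_le_univ _

end STPPPackingSumset

end Summit.MatrixMultiplication.MatrixMultiplication.Theorems
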